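import Summits.QuantumAdvantage.QuantumAdvantage.Theorems.WalkTwoStepPartLocality

/-!
# (G♯) local engine — toward `DensePinned p`: the generic SIGNED TRANSFER IDENTITY for a bit-driven automaton

Cell qa-qnc0, rung (G♯) = item stmt-QuantumAdvantage-23121 (planner qa-qnc0-p2 g24, ask P2-24b); prover qn-prover-3 g15.

Every transfer-operator proof of the dense pinned branch (the planner's enlarged state `ℤ_{3p} × {0,1}^{d₀}`, ROUND-24 §1ter (d), or the
lattice-restriction variant of PROVER3-MEMO-gen15 §4, or rung (G)'s `RungG.transfer` itself) is an instance of ONE identity: a deterministic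
automaton with state space `St`, time-dependent transition `δ t : St → Bool → St` driven by uniform input bits, and time-dependent real edge
weights `s t : St → Bool → ℝ` (the `±1` signs of the cuts evaluated at that step) satisfies
`Σ_{u ∈ {0,1}^m} (∏_{i<m} s (t+i) σ_i u_i) · φ(σ_m) = 2^m · (T_t ∘ T_{t+1} ∘ ⋯ ∘ T_{t+m−1}) φ (σ_0)`,
with the averaged signed step `(T_t f)(σ) = ½ Σ_b s t σ b · f (δ t σ b)` (`stepOp`, `runOps`, `pathVal`, **`sum_pathVal_eq`**).
Norm bookkeeping for the contraction arguments: if every `δ t · b` is injective and `|s| ≤ 1` then each step is an `ℓ²`-nonexpansion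
(`sumSq_stepOp_le`), hence so is every run (`sumSq_runOps_le`), and values are bounded pointwise by the `ℓ²` norm of the final weight
(`abs_runOps_apply_le`).  WHAT THIS IS NOT: no contraction (that is the block lemma (N1)), no instantiation to two-step strategies yet;
separation NOT moved.
-/

namespace Summit.QuantumAdvantage.AdviceFreeQNC0.LocalEngine

open Finset Classical

section Automaton

variable {St : Type*}

/-- The averaged signed step `(T f)(σ) = ½ (s σ 0 · f (δ σ 0) + s σ 1 · f (δ σ 1))`. -/
noncomputable def stepOp (δ : St → Bool → St) (s : St → Bool → ℝ) (f : St → ℝ) : St → ℝ :=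
  fun σ => (s σ false * f (δ σ false) + s σ true * f (δ σ true)) / 2

/-- The run of steps `t, t+1, …, t+m−1` applied to a final weight: `T_t (T_{t+1} (⋯ (T_{t+m−1} φ)))`. -/
noncomputable def runOps (δ : ℕ → St → Bool → St) (s : ℕ → St → Bool → ℝ) : ℕ → ℕ → (St → ℝ) → (St → ℝ)
  | _, 0, φ => φ
  | t, m + 1, φ => stepOp (δ t) (s t) (runOps δ s (t + 1) m φ)

/-- The signed value of the path driven by the bits `u` from state `σ` at time `t`, weighted by `φ` at the end:
`(∏_{i<m} s (t+i) σ_i u_i) · φ σ_m`. -/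
noncomputable def pathVal (δ : ℕ → St → Bool → St) (s : ℕ → St → Bool → ℝ) :
    ℕ → (m : ℕ) → St → (Fin m → Bool) → (St → ℝ) → ℝ
  | _, 0, σ, _, φ => φ σ
  | t, m + 1, σ, u, φ => s t σ (u 0) * pathVal δ s (t + 1) m (δ t σ (u 0)) (Fin.tail u) φ

/-- `runOps` unfolds one step. -/
theorem runOps_succ (δ : ℕ → St → Bool → St) (s : ℕ → St → Bool → ℝ) (t m : ℕ) (φ : St → ℝ) :
    runOps δ s t (m + 1) φ = stepOp (δ t) (s t) (runOps δ s (t + 1) m φ) := rfl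

/-- `pathVal` unfolds one step along `Fin.cons`. -/
theorem pathVal_cons (δ : ℕ → St → Bool → St) (s : ℕ → St → Bool → ℝ) (t m : ℕ) (σ : St) (b : Bool)
    (u : Fin m → Bool) (φ : St → ℝ) :
    pathVal δ s t (m + 1) σ (Fin.cons b u) φ = s t σ b * pathVal δ s (t + 1) m (δ t σ b) u φ := by
  simp only [pathVal, Fin.cons_zero, Fin.tail_cons]

/-- **Signed transfer identity**: the cube sum of signed path values is `2^m` times the operator run. -/
theorem sum_pathVal_eq (δ : ℕ → St → Bool → St) (s : ℕ → St → Bool → ℝ) :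
    ∀ (m t : ℕ) (σ : St) (φ : St → ℝ),
      ∑ u : Fin m → Bool, pathVal δ s t m σ u φ = (2 : ℝ) ^ m * runOps δ s t m φ σ
  | 0, t, σ, φ => by simp [pathVal, runOps]
  | m + 1, t, σ, φ => by
      rw [← Fintype.sum_equiv (Fin.consEquiv fun _ => Bool) (fun q => pathVal δ s t (m + 1) σ (Fin.cons q.1 q.2) φ) _
        (fun q => rfl)]
      rw [Fintype.sum_prod_type, Fintype.sum_bool]
      simp only [pathVal_cons]
      rw [← Finset.mul_sum, ← Finset.mul_sum, sum_pathVal_eq δ s m (t + 1) _ φ, sum_pathVal_eq δ s m (t + 1) _ φ,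
        runOps_succ, stepOp, pow_succ]
      ring

/-! ### Norm bookkeeping -/

variable [Fintype St]

/-- `ℓ²` mass of a weight. -/
noncomputable def sumSq (f : St → ℝ) : ℝ := ∑ σ, (f σ) ^ 2

/-- The `ℓ²` mass is nonnegative. -/
theorem sumSq_nonneg (f : St → ℝ) : 0 ≤ sumSq f := Finset.sum_nonneg fun _ _ => sq_nonneg _

/-- Re-indexing along an injective map does not increase the `ℓ²` mass. -/
theorem sumSq_comp_le_of_injective [DecidableEq St] (f : St → ℝ) (e : St → St) (he : Function.Injective e) :
    ∑ σ, (f (e σ)) ^ 2 ≤ sumSq f := by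
  unfold sumSq
  rw [← Finset.sum_image (f := fun τ => (f τ) ^ 2) (fun a _ b _ h => he h)]
  exact Finset.sum_le_sum_of_subset_of_nonneg (Finset.subset_univ _) fun τ _ _ => sq_nonneg _

/-- **One signed step is an `ℓ²`-nonexpansion** when both transitions are injective and the weights are bounded by `1`. -/
theorem sumSq_stepOp_le [DecidableEq St] (δ : St → Bool → St) (s : St → Bool → ℝ)
    (hδ : ∀ b, Function.Injective fun σ => δ σ b) (hs : ∀ σ b, |s σ b| ≤ 1) (f : St → ℝ) :
    sumSq (stepOp δ s f) ≤ sumSq f := by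
  have h1 : ∀ σ, (stepOp δ s f σ) ^ 2 ≤ ((f (δ σ false)) ^ 2 + (f (δ σ true)) ^ 2) / 2 := by
    intro σ
    unfold stepOp
    have ha := hs σ false
    have hb := hs σ true
    have ha2 : (s σ false) ^ 2 ≤ 1 := by
      have := abs_le.mp ha; nlinarith
    have hb2 : (s σ true) ^ 2 ≤ 1 := by
      have := abs_le.mp hb; nlinarith
    -- `((a x + b y)/2)² ≤ (x² + y²)/2` for `a², b² ≤ 1`
    nlinarith [sq_nonneg (s σ false * f (δ σ false) - s σ true * f (δ σ true)),
      mul_nonneg (sub_nonneg.mpr ha2) (sq_nonneg (f (δ σ false))),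
      mul_nonneg (sub_nonneg.mpr hb2) (sq_nonneg (f (δ σ true)))]
  calc sumSq (stepOp δ s f) = ∑ σ, (stepOp δ s f σ) ^ 2 := rfl
    _ ≤ ∑ σ, ((f (δ σ false)) ^ 2 + (f (δ σ true)) ^ 2) / 2 := Finset.sum_le_sum fun σ _ => h1 σ
    _ = (∑ σ, (f (δ σ false)) ^ 2 + ∑ σ, (f (δ σ true)) ^ 2) / 2 := by
        rw [← Finset.sum_add_distrib, Finset.sum_div]
    _ ≤ (sumSq f + sumSq f) / 2 := by
        have e1 := sumSq_comp_le_of_injective f (fun σ => δ σ false) (hδ false)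
        have e2 := sumSq_comp_le_of_injective f (fun σ => δ σ true) (hδ true)
        linarith
    _ = sumSq f := by ring

/-- **Every run is an `ℓ²`-nonexpansion** (under the same hypotheses at every time). -/
theorem sumSq_runOps_le [DecidableEq St] (δ : ℕ → St → Bool → St) (s : ℕ → St → Bool → ℝ)
    (hδ : ∀ t b, Function.Injective fun σ => δ t σ b) (hs : ∀ t σ b, |s t σ b| ≤ 1) :
    ∀ (m t : ℕ) (φ : St → ℝ), sumSq (runOps δ s t m φ) ≤ sumSq φ
  | 0, t, φ => le_rfl
  | m + 1, t, φ => by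
      rw [runOps_succ]
      exact (sumSq_stepOp_le (δ t) (s t) (hδ t) (hs t) _).trans (sumSq_runOps_le δ s hδ hs m (t + 1) φ)

/-- A value is bounded by the `ℓ²` norm. -/
theorem sq_apply_le_sumSq' (f : St → ℝ) (σ : St) : (f σ) ^ 2 ≤ sumSq f :=
  Finset.single_le_sum (f := fun τ => (f τ) ^ 2) (fun τ _ => sq_nonneg (f τ)) (Finset.mem_univ σ)

/-- **Pointwise bound for a run**: `|(run φ) σ| ≤ √(Σ φ²)`. -/
theorem abs_runOps_apply_le [DecidableEq St] (δ : ℕ → St → Bool → St) (s : ℕ → St → Bool → ℝ)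
    (hδ : ∀ t b, Function.Injective fun σ => δ t σ b) (hs : ∀ t σ b, |s t σ b| ≤ 1) (m t : ℕ) (φ : St → ℝ) (σ : St) :
    |runOps δ s t m φ σ| ≤ Real.sqrt (sumSq φ) := by
  have h := (sq_apply_le_sumSq' (runOps δ s t m φ) σ).trans (sumSq_runOps_le δ s hδ hs m t φ)
  rw [← Real.sqrt_sq_eq_abs]
  exact Real.sqrt_le_sqrt h

/-- **The cube sum of signed path values is at most `2^m · √(Σ φ²)` in absolute value** (transfer identity + nonexpansion). -/
theorem abs_sum_pathVal_le [DecidableEq St] (δ : ℕ → St → Bool → St) (s : ℕ → St → Bool → ℝ)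
    (hδ : ∀ t b, Function.Injective fun σ => δ t σ b) (hs : ∀ t σ b, |s t σ b| ≤ 1) (m t : ℕ) (σ : St) (φ : St → ℝ) :
    |∑ u : Fin m → Bool, pathVal δ s t m σ u φ| ≤ (2 : ℝ) ^ m * Real.sqrt (sumSq φ) := by
  rw [sum_pathVal_eq, abs_mul, abs_of_nonneg (by positivity : (0 : ℝ) ≤ (2 : ℝ) ^ m)]
  exact mul_le_mul_of_nonneg_left (abs_runOps_apply_le δ s hδ hs m t φ σ) (by positivity)

end Automaton

end Summit.QuantumAdvantage.AdviceFreeQNC0.LocalEngine
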